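/-
Copyright (c) 2026 the pub-hodgecm-mathlib formalisation cell (harness21).  Prover seat hodgecm-mathlib-A-p19 (g29): road «S3-ram» (LEAD F0P3a-plan (g13); owner ∕ (α) keeper
F0P3a-p06 (g16); (Cnt2′) chair F0P3a-p07 (g15), RULING (13)(2)), organ **«J2-FRAME-hyp»**, FILE 2: the CM dress at the J0diff binders; 2026-09-02.
-/
import Literature.NumberTheory.Automorphic.UnitaryLatticeTreeFrameLiteralCentring     -- (this seat, FILE 1): `ncard_{deep,rankOne,rankOneNot}_endoGL_eq_rerooted`, slots at `Γ = ι(B₀, 1)`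
import Literature.NumberTheory.Rogawski1990.TypeTwoRamifiedFrameLiteral                -- ★ (F0P3a-p03): the CM currency of the type-(2) literal; brings `localNonsplitEquiv`, `placeForm_antidiagOne`, `cmDatum`
import HarnessLib

/-!
# THE HYPERBOLIC TYPE-(2) LITERAL AT A TAMELY RAMIFIED CM PLACE, CENTRED AND RE-ROOTED — the (α) block-law rows of `ι(ĝ_w, û_w)` read at `Γ = ι(B₀, 1)`
# (Kottwitz 1986 §3; Rogawski 1990 §4.8–§4.9)

Topic `NumberTheory/Rogawski1990`; namespace `Literature.NumberTheory.Rogawski1990`.  THEOREMS ONLY (no definition, no instance, no notation, no named fact, no `sorry`);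
kernel lane `--supports stmt-HodgeConjecture-24833`.  Cell `pub/hodgecm-mathlib` (D-0151), crux H413; road «S3-ram» (Literature seeding, count-neutral): organ «J2-FRAME-hyp»
of the (α) BLOCK-LAW skeleton (chair F0P3a-p07 (g15) RULING (13)(2); (α) keeper F0P3a-p06 (g16); consumer F0P3a-p08 (g20)'s `stub_Zhyp_{row,par,branch}`).  This file
is the CM DRESS of FILE 1 (`UnitaryLatticeTreeFrameLiteralCentring`, generic `K`): `K := L_w`, `σ := σ_w = galAdicCompletionMap c hw`, the HYPERBOLIC literal
`ι(ĝ_w, û_w)` with `ĝ_w, û_w` the one-place images (★ `localNonsplitEquiv`) of `γ_H = (g, u) ∈ U(Φ₂)(F_v) × U(Φ₁)(F_v)` — EXACTLY the element of the (α) cells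
`stub_T2G_{zero,pm}_{even,odd}_J0diff` (A-p19 (g28) v0) — and the model form `placeForm Φ₃ w.1 = J₀` (★ `placeForm_antidiagOne`).  The centring unit `s` (`s·û₀₀ = 1`) and
the re-rooting frame `k ∈ U(σ_w, Φ₂,w)` (A-p12 (g25)'s centring conjugator, (4b)) are binders; the re-rooted centred block is **`B₀ = k⁻¹(s·ĝ_w)k`**, the literal
**`Γ = ι(B₀, 1) ∈ U(σ_w, J₀)`**.
HONEST LABEL: HC_CM is proved only modulo the 2 remaining named inputs (hLiu418 24832, h413 24833) until rung 0 closes; unconditional local algebra, count-neutral.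

* `v_oneByOne_eq_one_of_local` (`|û₀₀| = 1`), `oneByOne_mem_unitaryGroupOfForm_antidiagonal_of_local`, `twoByTwo_mem_unitaryGroupOfForm_antidiagonal_of_local` (the one-place
  images are unitary for `J₀⁽¹⁾`, `J₀⁽²⁾`), **`endoGL_rerootedCentred_mem_unitaryGroupOfForm_ram`** (`Γ ∈ U(σ_w, J₀)`),
* **`ncard_zero_frameLiteral_eq_rerooted_ram`**, **`ncard_pmClass_frameLiteral_eq_rerooted_ram`**, **`ncard_pmNotClass_frameLiteral_eq_rerooted_ram`** — the three J0diff
  hyperbolic set-builders (`SD (placeForm Φ₃ w.1)`, element `ι(ĝ_w, û_w)`, rows `LEV (ϖ²)` ∕ `1□_c` ∕ `¬1□_c`) have the `ncard` of the same rows AT `Γ` in the `J₀`-model,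
* `not_exists_isRoot_charpoly_rerootedCentred_ram` ∕ `forall_not_isRoot_charpoly_rerootedCentred_ram`, `v_disc_rerootedCentred_ram` (the socket's `hirr` ∕ `hdisc` move to `B₀`);
* §0 (generic, ns `UnitaryLatticeTree`) `v_smul_sub_one_apply_le_of_v_sub_smul_one_le` (the pen's `hd` at `B₀` from the centring bound + scalar depth),
  `coe_inv_mul_scalar_mul_mul_eq_smul` (`↑B₀ = s • ↑(k⁻¹ ĝ k)`).
* §4 (ED. 2) `v_mul_trace_div_two_sub_one_eq`, `forall_v_smul_conj_sub_one_le_of_centre_of_scalar` (generic), **`forall_v_rerootedCentred_sub_one_le_ram`** — THE ROOT DEPTH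
  OF `Γ`: `∀ i j, |(↑B₀ − 1) i j|_w ≤ |ϖ|^d` for every `d ≤ D` (centring depth) and `d ≤ e` (scalar depth `|2û₀₀ − tr ĝ_w|_w ≤ |ϖ^e|`).

## References
* [Kottwitz1986] R. E. Kottwitz, *Base change for unit elements of Hecke algebras*, Compositio Math. 60 (1986), §3.
* [Rogawski1990] J. D. Rogawski, *Automorphic Representations of Unitary Groups in Three Variables*, Ann. of Math. Stud. 123 (1990), §4.8 Case (a) p. 53, §4.9 pp. 54–55.
* [BruhatTits1972] F. Bruhat, J. Tits, *Groupes réductifs sur un corps local I*, Publ. Math. IHÉS 41 (1972), §10.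
* [PlatonovRapinchuk1994] V. Platonov, A. Rapinchuk, *Algebraic Groups and Number Theory* (1994), §2.3, §5.1 (one-place models).
-/

set_option autoImplicit false

noncomputable section

open NumberField IsDedekindDomain Matrix Polynomial
open Literature.NumberTheory.Automorphic Literature.NumberTheory.Automorphic.UnitaryGroup Literature.NumberTheory.Automorphic.UnitaryLatticeTree
open Literature.NumberTheory.Automorphic.HermitianLattice Literature.NumberTheory.GaloisRepresentations
open scoped MatrixGroups ValuativeRel Valued WithZero

namespace Literature.NumberTheory.Automorphic.UnitaryLatticeTree

/-! ## §0 One valuation lemma for the pen: the depth of `s·A − 1` from the traceless-centring bound and the scalar depth -/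

/-- **`|(s•A − 1)ᵢⱼ| ≤ C`** from `|(A − t•1)ᵢⱼ| ≤ C`, `|s| ≤ 1` and `|s·t − 1| ≤ C` (`s•A − 1 = s•(A − t•1) + (s·t − 1)•1`): the depth bound `hd` of the re-rooted centred
block `B₀ = s•(k⁻¹ĝk)` at `L₀` from A-p12's centring bound (`t = ½·tr`) and the scalar depth `|s·t − 1| ≤ |ϖ|^{d_c}`, at `C = |ϖ|^{min}`. [cite: Kottwitz1986, §3] [cite: Serre1980Trees, Ch. II §1.1] -/
theorem v_smul_sub_one_apply_le_of_v_sub_smul_one_le {K : Type*} [Field K] [Valued K ℤᵐ⁰] {N : ℕ} {A : Matrix (Fin N) (Fin N) K} {s t : K} {C : ℤᵐ⁰}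
    (hA : ∀ i j, Valued.v ((A - t • (1 : Matrix (Fin N) (Fin N) K)) i j) ≤ C) (hs : Valued.v s ≤ 1) (hst : Valued.v (s * t - 1) ≤ C) :
    ∀ i j, Valued.v ((s • A - 1) i j) ≤ C := by
  have e : s • A - 1 = s • (A - t • (1 : Matrix (Fin N) (Fin N) K)) + (s * t - 1) • (1 : Matrix (Fin N) (Fin N) K) := by
    rw [smul_sub, smul_smul, sub_smul, one_smul]; abel
  intro i j
  rw [e, Matrix.add_apply, Matrix.smul_apply, Matrix.smul_apply, smul_eq_mul, smul_eq_mul]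
  refine (Valuation.map_add _ _ _).trans (max_le ?_ ?_)
  · rw [map_mul]
    calc Valued.v s * Valued.v ((A - t • (1 : Matrix (Fin N) (Fin N) K)) i j) ≤ 1 * C := mul_le_mul' hs (hA i j)
      _ = C := one_mul C
  · rw [map_mul]
    rcases eq_or_ne i j with rfl | hij
    · rw [Matrix.one_apply_eq, map_one, mul_one]; exact hst
    · rw [Matrix.one_apply_ne hij, map_zero, mul_zero]; exact zero_le

/-- The same for the conjugated block: `|((s • (P⁻¹ A P)) − 1)ᵢⱼ| ≤ C` from `|((P⁻¹ A P) − t•1)ᵢⱼ| ≤ C`, `|s| ≤ 1`, `|s·t − 1| ≤ C`, with `↑(k⁻¹ * (scalar s * g) * k) =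
s • ↑(k⁻¹ * g * k)` (scalars are central) — the shape in which A-p12's centre lemma (`k⁻¹ * ↑ĝ * k − ½tr • 1`) meets FILE 1's `B₀`. [cite: Kottwitz1986, §3] -/
theorem coe_inv_mul_scalar_mul_mul_eq_smul {K : Type*} [Field K] (k g : GL (Fin 2) K) (s : Kˣ) :
    ((k⁻¹ * (Matrix.GeneralLinearGroup.scalar (Fin 2) s * g) * k : GL (Fin 2) K) : Matrix (Fin 2) (Fin 2) K) =
      (s : K) • ((k⁻¹ * g * k : GL (Fin 2) K) : Matrix (Fin 2) (Fin 2) K) := by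
  rw [Units.val_mul, Units.val_mul, coe_scalar_mul_eq_smul, Units.val_mul, Units.val_mul, Matrix.mul_smul, Matrix.smul_mul]

end Literature.NumberTheory.Automorphic.UnitaryLatticeTree

namespace Literature.NumberTheory.Rogawski1990

variable (L : Type) [Field L] [NumberField L] [IsCMField L] {v : HeightOneSpectrum (𝓞 ↥(maximalRealSubfield L))}
  (w : PlacesOver L v) (hw : IsCMField.complexConj L • w.1 = w.1)

/-! ## §1 The one-place images are unitary for `J₀⁽²⁾`, `J₀⁽¹⁾`; the middle eigenvalue is a norm-one unit; `Γ ∈ U(σ_w, J₀)` -/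

/-- The one-place image `ĝ_w` of the `U(Φ₂)`-component lies in `U(σ_w, J₀⁽²⁾)` (★ `localNonsplitEquiv` lands in `U(σ_w, placeForm Φ₂ w)` and ★ `placeForm_antidiagOne`).
[cite: PlatonovRapinchuk1994, §5.1] [cite: Rogawski1990, §4.8 Case (a) p. 53] -/
theorem twoByTwo_mem_unitaryGroupOfForm_antidiagonal_of_local
    (g : (cmDatum L 2 (Matrix.of fun i j : Fin 2 => if i.val + j.val + 1 = 2 then (1 : L) else 0)).Local v) :
    ((localNonsplitEquiv (IsCMField.complexConj L) (Matrix.of fun i j : Fin 2 => if i.val + j.val + 1 = 2 then (1 : L) else 0)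
        (IsCMField.complexConj_ne_one L) w hw g).val : GL (Fin 2) (w.1.adicCompletion L)) ∈
      unitaryGroupOfForm (galAdicCompletionMap (L := L) (IsCMField.complexConj L) hw) ((StdForm.antidiagonal 2).over (w.1.adicCompletion L)) := by
  rw [← placeForm_antidiagOne]
  exact (localNonsplitEquiv (IsCMField.complexConj L) _ (IsCMField.complexConj_ne_one L) w hw g).2

/-- The one-place image `û_w` of the `U(Φ₁)`-component lies in `U(σ_w, J₀⁽¹⁾)`. [cite: PlatonovRapinchuk1994, §5.1] [cite: Rogawski1990, §4.8 Case (a) p. 53] -/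
theorem oneByOne_mem_unitaryGroupOfForm_antidiagonal_of_local
    (u : (cmDatum L 1 (Matrix.of fun i j : Fin 1 => if i.val + j.val + 1 = 1 then (1 : L) else 0)).Local v) :
    ((localNonsplitEquiv (IsCMField.complexConj L) (Matrix.of fun i j : Fin 1 => if i.val + j.val + 1 = 1 then (1 : L) else 0)
        (IsCMField.complexConj_ne_one L) w hw u).val : GL (Fin 1) (w.1.adicCompletion L)) ∈
      unitaryGroupOfForm (galAdicCompletionMap (L := L) (IsCMField.complexConj L) hw) ((StdForm.antidiagonal 1).over (w.1.adicCompletion L)) := by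
  rw [← placeForm_antidiagOne]
  exact (localNonsplitEquiv (IsCMField.complexConj L) _ (IsCMField.complexConj_ne_one L) w hw u).2

/-- **`|û₀₀|_w = 1`**: the middle eigenvalue of a type-(2) `γ_H` is a norm-one unit at the non-split place (`σ_w(û₀₀)·û₀₀ = 1`, `σ_w` an isometry).
[cite: Rogawski1990, §4.8 Case (a) p. 53; §4.9 p. 55] -/
theorem v_oneByOne_eq_one_of_local
    (u : (cmDatum L 1 (Matrix.of fun i j : Fin 1 => if i.val + j.val + 1 = 1 then (1 : L) else 0)).Local v) :
    Valued.v ((((localNonsplitEquiv (IsCMField.complexConj L) (Matrix.of fun i j : Fin 1 => if i.val + j.val + 1 = 1 then (1 : L) else 0)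
        (IsCMField.complexConj_ne_one L) w hw u).val : GL (Fin 1) (w.1.adicCompletion L)) : Matrix (Fin 1) (Fin 1) (w.1.adicCompletion L)) 0 0) = 1 :=
  v_eq_one_of_map_mul_self_eq_one _ (fun x => valued_galAdicCompletionMap (L := L) (IsCMField.complexConj L) hw x)
    (map_mul_self_eq_one_of_mem_unitaryGroupOfForm_one (oneByOne_mem_unitaryGroupOfForm_antidiagonal_of_local L w hw u))

/-- **`Γ = ι(k⁻¹(s·ĝ_w)k, 1) ∈ U(σ_w, J₀)`** for `s·û₀₀ = 1` and any `k ∈ U(σ_w, Φ₂,w)` (FILE 1 `endoGL_rerootedCentred_mem_unitaryGroupOfForm` at the one-place images).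
[cite: Rogawski1990, §4.8 Case (a) p. 53; §4.9 p. 55] [cite: Kottwitz1986, §3] -/
theorem endoGL_rerootedCentred_mem_unitaryGroupOfForm_ram
    (γH : (cmDatum L 2 (Matrix.of fun i j : Fin 2 => if i.val + j.val + 1 = 2 then (1 : L) else 0)).Local v ×
      (cmDatum L 1 (Matrix.of fun i j : Fin 1 => if i.val + j.val + 1 = 1 then (1 : L) else 0)).Local v)
    (s : (w.1.adicCompletion L)ˣ)
    (hs : (s : w.1.adicCompletion L) * (((localNonsplitEquiv (IsCMField.complexConj L) (Matrix.of fun i j : Fin 1 => if i.val + j.val + 1 = 1 then (1 : L) else 0)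
        (IsCMField.complexConj_ne_one L) w hw γH.2).val : GL (Fin 1) (w.1.adicCompletion L)) : Matrix (Fin 1) (Fin 1) (w.1.adicCompletion L)) 0 0 = 1)
    (k : GL (Fin 2) (w.1.adicCompletion L))
    (hk : k ∈ unitaryGroupOfForm (galAdicCompletionMap (L := L) (IsCMField.complexConj L) hw)
      (placeForm (Matrix.of fun i j : Fin 2 => if i.val + j.val + 1 = 2 then (1 : L) else 0) w.1)) :
    endoGL (k⁻¹ * (Matrix.GeneralLinearGroup.scalar (Fin 2) s *
        ((localNonsplitEquiv (IsCMField.complexConj L) (Matrix.of fun i j : Fin 2 => if i.val + j.val + 1 = 2 then (1 : L) else 0)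
          (IsCMField.complexConj_ne_one L) w hw γH.1).val : GL (Fin 2) (w.1.adicCompletion L))) * k, (1 : GL (Fin 1) (w.1.adicCompletion L))) ∈
      unitaryGroupOfForm (galAdicCompletionMap (L := L) (IsCMField.complexConj L) hw) ((StdForm.antidiagonal 3).over (w.1.adicCompletion L)) := by
  rw [placeForm_antidiagOne] at hk
  exact endoGL_rerootedCentred_mem_unitaryGroupOfForm (twoByTwo_mem_unitaryGroupOfForm_antidiagonal_of_local L w hw γH.1)
    (oneByOne_mem_unitaryGroupOfForm_antidiagonal_of_local L w hw γH.2) hs hk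

/-! ## §2 The three J0diff rows of the hyperbolic literal, read at `Γ` -/

/-- **ROW `zero` OF THE HYPERBOLIC LITERAL, READ AT `Γ`**: the (α) cell's set `{M ∣ SD_{Φ₃,w} M ∧ ι(ĝ_w, û_w)·M = M ∧ LEV (ϖ²)}` (the `stub_T2G_zero_{par}_J0diff` first
set-builder VERBATIM) has the cardinality of `{M ∣ SD_{J₀} M ∧ Γ·M = M ∧ LEV (ϖ²)}`, `Γ = ι(k⁻¹(s·ĝ_w)k, 1)` — for `s·û₀₀ = 1` (`û₀₀` 2-deep: the cell's `hu2`) and any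
`k ∈ U(σ_w, Φ₂,w)`.  (FILE 1 `ncard_deep_endoGL_eq_rerooted` ∘ ★ `placeForm_antidiagOne`.) [cite: Kottwitz1986, §3] [cite: Rogawski1990, §4.9 pp. 54–55, Lemma 4.9.3] -/
theorem ncard_zero_frameLiteral_eq_rerooted_ram (ϖ : w.1.adicCompletion L) (hϖ : Valued.v ϖ = WithZero.exp (-1 : ℤ))
    (γH : (cmDatum L 2 (Matrix.of fun i j : Fin 2 => if i.val + j.val + 1 = 2 then (1 : L) else 0)).Local v ×
      (cmDatum L 1 (Matrix.of fun i j : Fin 1 => if i.val + j.val + 1 = 1 then (1 : L) else 0)).Local v)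
    (hu2 : Valued.v (finGammaTwo L v γH w - 1) ≤ Valued.v (ϖ ^ 2))
    (s : (w.1.adicCompletion L)ˣ)
    (hs : (s : w.1.adicCompletion L) * (((localNonsplitEquiv (IsCMField.complexConj L) (Matrix.of fun i j : Fin 1 => if i.val + j.val + 1 = 1 then (1 : L) else 0)
        (IsCMField.complexConj_ne_one L) w hw γH.2).val : GL (Fin 1) (w.1.adicCompletion L)) : Matrix (Fin 1) (Fin 1) (w.1.adicCompletion L)) 0 0 = 1)
    (k : GL (Fin 2) (w.1.adicCompletion L))
    (hk : k ∈ unitaryGroupOfForm (galAdicCompletionMap (L := L) (IsCMField.complexConj L) hw)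
      (placeForm (Matrix.of fun i j : Fin 2 => if i.val + j.val + 1 = 2 then (1 : L) else 0) w.1)) :
    {M : Submodule (Valued.integer (w.1.adicCompletion L)) (Fin 3 → (w.1.adicCompletion L)) | IsSelfDualLattice (galAdicCompletionMap (L := L) (IsCMField.complexConj L) hw) ϖ (placeForm (Matrix.of fun i j : Fin 3 => if i.val + j.val + 1 = 3 then (1 : L) else 0) w.1) M ∧ mapGL (endoGL (((localNonsplitEquiv (IsCMField.complexConj L) (Matrix.of fun i j : Fin 2 => if i.val + j.val + 1 = 2 then (1 : L) else 0) (IsCMField.complexConj_ne_one L) w hw γH.1).val : GL (Fin 2) (w.1.adicCompletion L)), ((localNonsplitEquiv (IsCMField.complexConj L) (Matrix.of fun i j : Fin 1 => if i.val + j.val + 1 = 1 then (1 : L) else 0) (IsCMField.complexConj_ne_one L) w hw γH.2).val : GL (Fin 1) (w.1.adicCompletion L)))) M = M ∧ M.map ((Matrix.toLin' (((endoGL (((localNonsplitEquiv (IsCMField.complexConj L) (Matrix.of fun i j : Fin 2 => if i.val + j.val + 1 = 2 then (1 : L) else 0) (IsCMField.complexConj_ne_one L) w hw γH.1).val : GL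 (Fin 2) (w.1.adicCompletion L)), ((localNonsplitEquiv (IsCMField.complexConj L) (Matrix.of fun i j : Fin 1 => if i.val + j.val + 1 = 1 then (1 : L) else 0) (IsCMField.complexConj_ne_one L) w hw γH.2).val : GL (Fin 1) (w.1.adicCompletion L))) : GL (Fin 3) (w.1.adicCompletion L)) : Matrix (Fin 3) (Fin 3) (w.1.adicCompletion L)) - 1)).restrictScalars (Valued.integer (w.1.adicCompletion L))) ≤ scaleLattice (ϖ ^ 2) M}.ncard =
      {M : Submodule (Valued.integer (w.1.adicCompletion L)) (Fin 3 → (w.1.adicCompletion L)) |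
        IsSelfDualLattice (galAdicCompletionMap (L := L) (IsCMField.complexConj L) hw) ϖ ((StdForm.antidiagonal 3).over (w.1.adicCompletion L)) M ∧
        mapGL (endoGL (k⁻¹ * (Matrix.GeneralLinearGroup.scalar (Fin 2) s *
          ((localNonsplitEquiv (IsCMField.complexConj L) (Matrix.of fun i j : Fin 2 => if i.val + j.val + 1 = 2 then (1 : L) else 0)
            (IsCMField.complexConj_ne_one L) w hw γH.1).val : GL (Fin 2) (w.1.adicCompletion L))) * k, (1 : GL (Fin 1) (w.1.adicCompletion L)))) M = M ∧
        M.map ((Matrix.toLin' (((endoGL (k⁻¹ * (Matrix.GeneralLinearGroup.scalar (Fin 2) s *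
          ((localNonsplitEquiv (IsCMField.complexConj L) (Matrix.of fun i j : Fin 2 => if i.val + j.val + 1 = 2 then (1 : L) else 0)
            (IsCMField.complexConj_ne_one L) w hw γH.1).val : GL (Fin 2) (w.1.adicCompletion L))) * k, (1 : GL (Fin 1) (w.1.adicCompletion L))) :
              GL (Fin 3) (w.1.adicCompletion L)) : Matrix (Fin 3) (Fin 3) (w.1.adicCompletion L)) - 1)).restrictScalars (Valued.integer (w.1.adicCompletion L))) ≤
          scaleLattice (ϖ ^ 2) M}.ncard := by
  rw [map_pow] at hu2
  rw [placeForm_antidiagOne] at hk ⊢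
  exact ncard_deep_endoGL_eq_rerooted (fun x => valued_galAdicCompletionMap (L := L) (IsCMField.complexConj L) hw x) hϖ _ k _ s
    (v_oneByOne_eq_one_of_local L w hw γH.2) hu2 hs hk

set_option maxHeartbeats 400000 in
/-- **ROW `1□_c` OF THE HYPERBOLIC LITERAL, READ AT `Γ`** (the `stub_T2G_pm_{par}_J0diff` first set-builder VERBATIM: `LEV (ϖ)`, `¬LEV (ϖ²)`, `LEV₂ (ϖ³)`, class token of the
cell's constant `c` with normaliser `ϖ⁻¹`). [cite: Kottwitz1986, §3] [cite: Rogawski1990, §4.9 pp. 54–55, Lemma 4.9.3] -/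
theorem ncard_pmClass_frameLiteral_eq_rerooted_ram (ϖ : w.1.adicCompletion L) (hϖ : Valued.v ϖ = WithZero.exp (-1 : ℤ)) (c : w.1.adicCompletion L)
    (γH : (cmDatum L 2 (Matrix.of fun i j : Fin 2 => if i.val + j.val + 1 = 2 then (1 : L) else 0)).Local v ×
      (cmDatum L 1 (Matrix.of fun i j : Fin 1 => if i.val + j.val + 1 = 1 then (1 : L) else 0)).Local v)
    (hu2 : Valued.v (finGammaTwo L v γH w - 1) ≤ Valued.v (ϖ ^ 2))
    (s : (w.1.adicCompletion L)ˣ)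
    (hs : (s : w.1.adicCompletion L) * (((localNonsplitEquiv (IsCMField.complexConj L) (Matrix.of fun i j : Fin 1 => if i.val + j.val + 1 = 1 then (1 : L) else 0)
        (IsCMField.complexConj_ne_one L) w hw γH.2).val : GL (Fin 1) (w.1.adicCompletion L)) : Matrix (Fin 1) (Fin 1) (w.1.adicCompletion L)) 0 0 = 1)
    (k : GL (Fin 2) (w.1.adicCompletion L))
    (hk : k ∈ unitaryGroupOfForm (galAdicCompletionMap (L := L) (IsCMField.complexConj L) hw)
      (placeForm (Matrix.of fun i j : Fin 2 => if i.val + j.val + 1 = 2 then (1 : L) else 0) w.1)) :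
    {M : Submodule (Valued.integer (w.1.adicCompletion L)) (Fin 3 → (w.1.adicCompletion L)) | IsSelfDualLattice (galAdicCompletionMap (L := L) (IsCMField.complexConj L) hw) ϖ (placeForm (Matrix.of fun i j : Fin 3 => if i.val + j.val + 1 = 3 then (1 : L) else 0) w.1) M ∧ mapGL (endoGL (((localNonsplitEquiv (IsCMField.complexConj L) (Matrix.of fun i j : Fin 2 => if i.val + j.val + 1 = 2 then (1 : L) else 0) (IsCMField.complexConj_ne_one L) w hw γH.1).val : GL (Fin 2) (w.1.adicCompletion L)), ((localNonsplitEquiv (IsCMField.complexConj L) (Matrix.of fun i j : Fin 1 => if i.val + j.val + 1 = 1 then (1 : L) else 0) (IsCMField.complexConj_ne_one L) w hw γH.2).val : GL (Fin 1) (w.1.adicCompletion L)))) M = M ∧ (M.map ((Matrix.toLin' (((endoGL (((localNonsplitEquiv (IsCMField.complexConj L) (Matrix.of fun i j : Fin 2 => if i.val + j.val + 1 = 2 then (1 : L) else 0) (IsCMField.complexConj_ne_one L) w hw γH.1).val : GL (Fin 2) (w.1.adicCompletion L)), ((localNonsplitEquiv (IsCMField.complexConj L) (Matrix.of fun i j :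 Fin 1 => if i.val + j.val + 1 = 1 then (1 : L) else 0) (IsCMField.complexConj_ne_one L) w hw γH.2).val : GL (Fin 1) (w.1.adicCompletion L))) : GL (Fin 3) (w.1.adicCompletion L)) : Matrix (Fin 3) (Fin 3) (w.1.adicCompletion L)) - 1)).restrictScalars (Valued.integer (w.1.adicCompletion L))) ≤ scaleLattice ϖ M ∧ ¬ M.map ((Matrix.toLin' (((endoGL (((localNonsplitEquiv (IsCMField.complexConj L) (Matrix.of fun i j : Fin 2 => if i.val + j.val + 1 = 2 then (1 : L) else 0) (IsCMField.complexConj_ne_one L) w hw γH.1).val : GL (Fin 2) (w.1.adicCompletion L)), ((localNonsplitEquiv (IsCMField.complexConj L) (Matrix.of fun i j : Fin 1 => if i.val + j.val + 1 = 1 then (1 : L) else 0) (IsCMField.complexConj_ne_one L) w hw γH.2).val : GL (Fin 1) (w.1.adicCompletion L))) : GL (Fin 3) (w.1.adicCompletion L)) : Matrix (Fin 3) (Fin 3) (w.1.adicCompletion L)) - 1)).restrictScalars (Valued.integer (w.1.adicCompletion L))) ≤ scaleLattice (ϖ ^ 2) M ∧ M.map ((Matrix.toLin' ((((endoGL (((localNonsplitEquiv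 (IsCMField.complexConj L) (Matrix.of fun i j : Fin 2 => if i.val + j.val + 1 = 2 then (1 : L) else 0) (IsCMField.complexConj_ne_one L) w hw γH.1).val : GL (Fin 2) (w.1.adicCompletion L)), ((localNonsplitEquiv (IsCMField.complexConj L) (Matrix.of fun i j : Fin 1 => if i.val + j.val + 1 = 1 then (1 : L) else 0) (IsCMField.complexConj_ne_one L) w hw γH.2).val : GL (Fin 1) (w.1.adicCompletion L))) : GL (Fin 3) (w.1.adicCompletion L)) : Matrix (Fin 3) (Fin 3) (w.1.adicCompletion L)) - 1) ^ 2)).restrictScalars (Valued.integer (w.1.adicCompletion L))) ≤ scaleLattice (ϖ ^ 3) M ∧ ∃ y ∈ M, ∃ a : (w.1.adicCompletion L), Valued.v a = 1 ∧ Valued.v (ϖ⁻¹ * pairing (galAdicCompletionMap (L := L) (IsCMField.complexConj L) hw) (placeForm (Matrix.of fun i j : Fin 3 => if i.val + j.val + 1 = 3 then (1 : L) else 0) w.1) y ((((endoGL (((localNonsplitEquiv (IsCMField.complexConj L) (Matrix.of fun i j : Fin 2 => if i.val + j.val + 1 = 2 then (1 : L) else 0) (IsCMField.complexConj_ne_one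 L) w hw γH.1).val : GL (Fin 2) (w.1.adicCompletion L)), ((localNonsplitEquiv (IsCMField.complexConj L) (Matrix.of fun i j : Fin 1 => if i.val + j.val + 1 = 1 then (1 : L) else 0) (IsCMField.complexConj_ne_one L) w hw γH.2).val : GL (Fin 1) (w.1.adicCompletion L))) : GL (Fin 3) (w.1.adicCompletion L)) : Matrix (Fin 3) (Fin 3) (w.1.adicCompletion L)) - 1) *ᵥ y) - c * a ^ 2) < 1)}.ncard =
      {M : Submodule (Valued.integer (w.1.adicCompletion L)) (Fin 3 → (w.1.adicCompletion L)) |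
        IsSelfDualLattice (galAdicCompletionMap (L := L) (IsCMField.complexConj L) hw) ϖ ((StdForm.antidiagonal 3).over (w.1.adicCompletion L)) M ∧
        mapGL (endoGL (k⁻¹ * (Matrix.GeneralLinearGroup.scalar (Fin 2) s *
          ((localNonsplitEquiv (IsCMField.complexConj L) (Matrix.of fun i j : Fin 2 => if i.val + j.val + 1 = 2 then (1 : L) else 0)
            (IsCMField.complexConj_ne_one L) w hw γH.1).val : GL (Fin 2) (w.1.adicCompletion L))) * k, (1 : GL (Fin 1) (w.1.adicCompletion L)))) M = M ∧
        (M.map ((Matrix.toLin' (((endoGL (k⁻¹ * (Matrix.GeneralLinearGroup.scalar (Fin 2) s *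
          ((localNonsplitEquiv (IsCMField.complexConj L) (Matrix.of fun i j : Fin 2 => if i.val + j.val + 1 = 2 then (1 : L) else 0)
            (IsCMField.complexConj_ne_one L) w hw γH.1).val : GL (Fin 2) (w.1.adicCompletion L))) * k, (1 : GL (Fin 1) (w.1.adicCompletion L))) :
              GL (Fin 3) (w.1.adicCompletion L)) : Matrix (Fin 3) (Fin 3) (w.1.adicCompletion L)) - 1)).restrictScalars (Valued.integer (w.1.adicCompletion L))) ≤
            scaleLattice ϖ M ∧
          ¬ M.map ((Matrix.toLin' (((endoGL (k⁻¹ * (Matrix.GeneralLinearGroup.scalar (Fin 2) s *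
            ((localNonsplitEquiv (IsCMField.complexConj L) (Matrix.of fun i j : Fin 2 => if i.val + j.val + 1 = 2 then (1 : L) else 0)
              (IsCMField.complexConj_ne_one L) w hw γH.1).val : GL (Fin 2) (w.1.adicCompletion L))) * k, (1 : GL (Fin 1) (w.1.adicCompletion L))) :
                GL (Fin 3) (w.1.adicCompletion L)) : Matrix (Fin 3) (Fin 3) (w.1.adicCompletion L)) - 1)).restrictScalars (Valued.integer (w.1.adicCompletion L))) ≤
              scaleLattice (ϖ ^ 2) M ∧
          M.map ((Matrix.toLin' ((((endoGL (k⁻¹ * (Matrix.GeneralLinearGroup.scalar (Fin 2) s *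
            ((localNonsplitEquiv (IsCMField.complexConj L) (Matrix.of fun i j : Fin 2 => if i.val + j.val + 1 = 2 then (1 : L) else 0)
              (IsCMField.complexConj_ne_one L) w hw γH.1).val : GL (Fin 2) (w.1.adicCompletion L))) * k, (1 : GL (Fin 1) (w.1.adicCompletion L))) :
                GL (Fin 3) (w.1.adicCompletion L)) : Matrix (Fin 3) (Fin 3) (w.1.adicCompletion L)) - 1) ^ 2)).restrictScalars (Valued.integer (w.1.adicCompletion L))) ≤
              scaleLattice (ϖ ^ 3) M ∧
          ∃ y ∈ M, ∃ a : (w.1.adicCompletion L), Valued.v a = 1 ∧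
            Valued.v (ϖ⁻¹ * pairing (galAdicCompletionMap (L := L) (IsCMField.complexConj L) hw) ((StdForm.antidiagonal 3).over (w.1.adicCompletion L)) y
              ((((endoGL (k⁻¹ * (Matrix.GeneralLinearGroup.scalar (Fin 2) s *
                ((localNonsplitEquiv (IsCMField.complexConj L) (Matrix.of fun i j : Fin 2 => if i.val + j.val + 1 = 2 then (1 : L) else 0)
                  (IsCMField.complexConj_ne_one L) w hw γH.1).val : GL (Fin 2) (w.1.adicCompletion L))) * k, (1 : GL (Fin 1) (w.1.adicCompletion L))) :
                    GL (Fin 3) (w.1.adicCompletion L)) : Matrix (Fin 3) (Fin 3) (w.1.adicCompletion L)) - 1) *ᵥ y) - c * a ^ 2) < 1)}.ncard := by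
  rw [map_pow] at hu2
  rw [placeForm_antidiagOne] at hk ⊢
  exact ncard_rankOne_endoGL_eq_rerooted (fun x => valued_galAdicCompletionMap (L := L) (IsCMField.complexConj L) hw x) hϖ _ k _ s
    (v_oneByOne_eq_one_of_local L w hw γH.2) hu2 hs hk c

set_option maxHeartbeats 400000 in
/-- **ROW `¬1□_c` OF THE HYPERBOLIC LITERAL, READ AT `Γ`** (the `stub_T2G_pm_{par}_J0diff` second set-builder VERBATIM: same level tokens, NEGATED class token).
[cite: Kottwitz1986, §3] [cite: Rogawski1990, §4.9 pp. 54–55, Lemma 4.9.3] -/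
theorem ncard_pmNotClass_frameLiteral_eq_rerooted_ram (ϖ : w.1.adicCompletion L) (hϖ : Valued.v ϖ = WithZero.exp (-1 : ℤ)) (c : w.1.adicCompletion L)
    (γH : (cmDatum L 2 (Matrix.of fun i j : Fin 2 => if i.val + j.val + 1 = 2 then (1 : L) else 0)).Local v ×
      (cmDatum L 1 (Matrix.of fun i j : Fin 1 => if i.val + j.val + 1 = 1 then (1 : L) else 0)).Local v)
    (hu2 : Valued.v (finGammaTwo L v γH w - 1) ≤ Valued.v (ϖ ^ 2))
    (s : (w.1.adicCompletion L)ˣ)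
    (hs : (s : w.1.adicCompletion L) * (((localNonsplitEquiv (IsCMField.complexConj L) (Matrix.of fun i j : Fin 1 => if i.val + j.val + 1 = 1 then (1 : L) else 0)
        (IsCMField.complexConj_ne_one L) w hw γH.2).val : GL (Fin 1) (w.1.adicCompletion L)) : Matrix (Fin 1) (Fin 1) (w.1.adicCompletion L)) 0 0 = 1)
    (k : GL (Fin 2) (w.1.adicCompletion L))
    (hk : k ∈ unitaryGroupOfForm (galAdicCompletionMap (L := L) (IsCMField.complexConj L) hw)
      (placeForm (Matrix.of fun i j : Fin 2 => if i.val + j.val + 1 = 2 then (1 : L) else 0) w.1)) :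
    {M : Submodule (Valued.integer (w.1.adicCompletion L)) (Fin 3 → (w.1.adicCompletion L)) | IsSelfDualLattice (galAdicCompletionMap (L := L) (IsCMField.complexConj L) hw) ϖ (placeForm (Matrix.of fun i j : Fin 3 => if i.val + j.val + 1 = 3 then (1 : L) else 0) w.1) M ∧ mapGL (endoGL (((localNonsplitEquiv (IsCMField.complexConj L) (Matrix.of fun i j : Fin 2 => if i.val + j.val + 1 = 2 then (1 : L) else 0) (IsCMField.complexConj_ne_one L) w hw γH.1).val : GL (Fin 2) (w.1.adicCompletion L)), ((localNonsplitEquiv (IsCMField.complexConj L) (Matrix.of fun i j : Fin 1 => if i.val + j.val + 1 = 1 then (1 : L) else 0) (IsCMField.complexConj_ne_one L) w hw γH.2).val : GL (Fin 1) (w.1.adicCompletion L)))) M = M ∧ (M.map ((Matrix.toLin' (((endoGL (((localNonsplitEquiv (IsCMField.complexConj L) (Matrix.of fun i j : Fin 2 => if i.val + j.val + 1 = 2 then (1 : L) else 0) (IsCMField.complexConj_ne_one L) w hw γH.1).val : GL (Fin 2) (w.1.adicCompletion L)), ((localNonsplitEquiv (IsCMField.complexConj L) (Matrix.of fun i j :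 Fin 1 => if i.val + j.val + 1 = 1 then (1 : L) else 0) (IsCMField.complexConj_ne_one L) w hw γH.2).val : GL (Fin 1) (w.1.adicCompletion L))) : GL (Fin 3) (w.1.adicCompletion L)) : Matrix (Fin 3) (Fin 3) (w.1.adicCompletion L)) - 1)).restrictScalars (Valued.integer (w.1.adicCompletion L))) ≤ scaleLattice ϖ M ∧ ¬ M.map ((Matrix.toLin' (((endoGL (((localNonsplitEquiv (IsCMField.complexConj L) (Matrix.of fun i j : Fin 2 => if i.val + j.val + 1 = 2 then (1 : L) else 0) (IsCMField.complexConj_ne_one L) w hw γH.1).val : GL (Fin 2) (w.1.adicCompletion L)), ((localNonsplitEquiv (IsCMField.complexConj L) (Matrix.of fun i j : Fin 1 => if i.val + j.val + 1 = 1 then (1 : L) else 0) (IsCMField.complexConj_ne_one L) w hw γH.2).val : GL (Fin 1) (w.1.adicCompletion L))) : GL (Fin 3) (w.1.adicCompletion L)) : Matrix (Fin 3) (Fin 3) (w.1.adicCompletion L)) - 1)).restrictScalars (Valued.integer (w.1.adicCompletion L))) ≤ scaleLattice (ϖ ^ 2) M ∧ M.map ((Matrix.toLin' ((((endoGL (((localNonsplitEquiv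 (IsCMField.complexConj L) (Matrix.of fun i j : Fin 2 => if i.val + j.val + 1 = 2 then (1 : L) else 0) (IsCMField.complexConj_ne_one L) w hw γH.1).val : GL (Fin 2) (w.1.adicCompletion L)), ((localNonsplitEquiv (IsCMField.complexConj L) (Matrix.of fun i j : Fin 1 => if i.val + j.val + 1 = 1 then (1 : L) else 0) (IsCMField.complexConj_ne_one L) w hw γH.2).val : GL (Fin 1) (w.1.adicCompletion L))) : GL (Fin 3) (w.1.adicCompletion L)) : Matrix (Fin 3) (Fin 3) (w.1.adicCompletion L)) - 1) ^ 2)).restrictScalars (Valued.integer (w.1.adicCompletion L))) ≤ scaleLattice (ϖ ^ 3) M ∧ ¬ ∃ y ∈ M, ∃ a : (w.1.adicCompletion L), Valued.v a = 1 ∧ Valued.v (ϖ⁻¹ * pairing (galAdicCompletionMap (L := L) (IsCMField.complexConj L) hw) (placeForm (Matrix.of fun i j : Fin 3 => if i.val + j.val + 1 = 3 then (1 : L) else 0) w.1) y ((((endoGL (((localNonsplitEquiv (IsCMField.complexConj L) (Matrix.of fun i j : Fin 2 => if i.val + j.val + 1 = 2 then (1 : L) else 0) (IsCMField.complexConj_ne_one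 L) w hw γH.1).val : GL (Fin 2) (w.1.adicCompletion L)), ((localNonsplitEquiv (IsCMField.complexConj L) (Matrix.of fun i j : Fin 1 => if i.val + j.val + 1 = 1 then (1 : L) else 0) (IsCMField.complexConj_ne_one L) w hw γH.2).val : GL (Fin 1) (w.1.adicCompletion L))) : GL (Fin 3) (w.1.adicCompletion L)) : Matrix (Fin 3) (Fin 3) (w.1.adicCompletion L)) - 1) *ᵥ y) - c * a ^ 2) < 1)}.ncard =
      {M : Submodule (Valued.integer (w.1.adicCompletion L)) (Fin 3 → (w.1.adicCompletion L)) |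
        IsSelfDualLattice (galAdicCompletionMap (L := L) (IsCMField.complexConj L) hw) ϖ ((StdForm.antidiagonal 3).over (w.1.adicCompletion L)) M ∧
        mapGL (endoGL (k⁻¹ * (Matrix.GeneralLinearGroup.scalar (Fin 2) s *
          ((localNonsplitEquiv (IsCMField.complexConj L) (Matrix.of fun i j : Fin 2 => if i.val + j.val + 1 = 2 then (1 : L) else 0)
            (IsCMField.complexConj_ne_one L) w hw γH.1).val : GL (Fin 2) (w.1.adicCompletion L))) * k, (1 : GL (Fin 1) (w.1.adicCompletion L)))) M = M ∧
        (M.map ((Matrix.toLin' (((endoGL (k⁻¹ * (Matrix.GeneralLinearGroup.scalar (Fin 2) s *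
          ((localNonsplitEquiv (IsCMField.complexConj L) (Matrix.of fun i j : Fin 2 => if i.val + j.val + 1 = 2 then (1 : L) else 0)
            (IsCMField.complexConj_ne_one L) w hw γH.1).val : GL (Fin 2) (w.1.adicCompletion L))) * k, (1 : GL (Fin 1) (w.1.adicCompletion L))) :
              GL (Fin 3) (w.1.adicCompletion L)) : Matrix (Fin 3) (Fin 3) (w.1.adicCompletion L)) - 1)).restrictScalars (Valued.integer (w.1.adicCompletion L))) ≤
            scaleLattice ϖ M ∧
          ¬ M.map ((Matrix.toLin' (((endoGL (k⁻¹ * (Matrix.GeneralLinearGroup.scalar (Fin 2) s *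
            ((localNonsplitEquiv (IsCMField.complexConj L) (Matrix.of fun i j : Fin 2 => if i.val + j.val + 1 = 2 then (1 : L) else 0)
              (IsCMField.complexConj_ne_one L) w hw γH.1).val : GL (Fin 2) (w.1.adicCompletion L))) * k, (1 : GL (Fin 1) (w.1.adicCompletion L))) :
                GL (Fin 3) (w.1.adicCompletion L)) : Matrix (Fin 3) (Fin 3) (w.1.adicCompletion L)) - 1)).restrictScalars (Valued.integer (w.1.adicCompletion L))) ≤
              scaleLattice (ϖ ^ 2) M ∧
          M.map ((Matrix.toLin' ((((endoGL (k⁻¹ * (Matrix.GeneralLinearGroup.scalar (Fin 2) s *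
            ((localNonsplitEquiv (IsCMField.complexConj L) (Matrix.of fun i j : Fin 2 => if i.val + j.val + 1 = 2 then (1 : L) else 0)
              (IsCMField.complexConj_ne_one L) w hw γH.1).val : GL (Fin 2) (w.1.adicCompletion L))) * k, (1 : GL (Fin 1) (w.1.adicCompletion L))) :
                GL (Fin 3) (w.1.adicCompletion L)) : Matrix (Fin 3) (Fin 3) (w.1.adicCompletion L)) - 1) ^ 2)).restrictScalars (Valued.integer (w.1.adicCompletion L))) ≤
              scaleLattice (ϖ ^ 3) M ∧
          ¬ ∃ y ∈ M, ∃ a : (w.1.adicCompletion L), Valued.v a = 1 ∧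
            Valued.v (ϖ⁻¹ * pairing (galAdicCompletionMap (L := L) (IsCMField.complexConj L) hw) ((StdForm.antidiagonal 3).over (w.1.adicCompletion L)) y
              ((((endoGL (k⁻¹ * (Matrix.GeneralLinearGroup.scalar (Fin 2) s *
                ((localNonsplitEquiv (IsCMField.complexConj L) (Matrix.of fun i j : Fin 2 => if i.val + j.val + 1 = 2 then (1 : L) else 0)
                  (IsCMField.complexConj_ne_one L) w hw γH.1).val : GL (Fin 2) (w.1.adicCompletion L))) * k, (1 : GL (Fin 1) (w.1.adicCompletion L))) :
                    GL (Fin 3) (w.1.adicCompletion L)) : Matrix (Fin 3) (Fin 3) (w.1.adicCompletion L)) - 1) *ᵥ y) - c * a ^ 2) < 1)}.ncard := by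
  rw [map_pow] at hu2
  rw [placeForm_antidiagOne] at hk ⊢
  exact ncard_rankOneNot_endoGL_eq_rerooted (fun x => valued_galAdicCompletionMap (L := L) (IsCMField.complexConj L) hw x) hϖ _ k _ s
    (v_oneByOne_eq_one_of_local L w hw γH.2) hu2 hs hk c

/-! ## §3 The socket's spectral data move to `B₀` -/

/-- **`χ_{B₀}` is rootless** when `χ_{ĝ_w}` is (the cell's `hirr`), `B₀ = k⁻¹(s·ĝ_w)k`. [cite: Rogawski1990, §4.9 p. 55; §3.1 p. 19] -/
theorem not_exists_isRoot_charpoly_rerootedCentred_ram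
    (γH : (cmDatum L 2 (Matrix.of fun i j : Fin 2 => if i.val + j.val + 1 = 2 then (1 : L) else 0)).Local v ×
      (cmDatum L 1 (Matrix.of fun i j : Fin 1 => if i.val + j.val + 1 = 1 then (1 : L) else 0)).Local v)
    (hirr : ¬ ∃ x : (w.1.adicCompletion L), ((((γH.1.val : GL (Fin 2) (UnitaryGroup.LocalRing L v)).val.map
      (Pi.evalRingHom (fun w' : PlacesOver L v => w'.1.adicCompletion L) w))).charpoly).IsRoot x)
    (s : (w.1.adicCompletion L)ˣ) (k : GL (Fin 2) (w.1.adicCompletion L)) :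
    ¬ ∃ x : (w.1.adicCompletion L), ((k⁻¹ * (Matrix.GeneralLinearGroup.scalar (Fin 2) s *
        ((localNonsplitEquiv (IsCMField.complexConj L) (Matrix.of fun i j : Fin 2 => if i.val + j.val + 1 = 2 then (1 : L) else 0)
          (IsCMField.complexConj_ne_one L) w hw γH.1).val : GL (Fin 2) (w.1.adicCompletion L))) * k : GL (Fin 2) (w.1.adicCompletion L)) :
            Matrix (Fin 2) (Fin 2) (w.1.adicCompletion L)).charpoly.IsRoot x :=
  not_exists_isRoot_charpoly_rerooted_centred _ k s (by rw [coe_localNonsplitEquiv_apply]; exact hirr)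

/-- The same in the `∀ x, ¬` shape consumed by FILE 1's `finite_setOf_latticeGraphIso_endoGL_one_antidiagonal` (`hirr`) (ref5 R-433 seam note). [cite: Rogawski1990, §4.9 p. 55] -/
theorem forall_not_isRoot_charpoly_rerootedCentred_ram
    (γH : (cmDatum L 2 (Matrix.of fun i j : Fin 2 => if i.val + j.val + 1 = 2 then (1 : L) else 0)).Local v ×
      (cmDatum L 1 (Matrix.of fun i j : Fin 1 => if i.val + j.val + 1 = 1 then (1 : L) else 0)).Local v)
    (hirr : ¬ ∃ x : (w.1.adicCompletion L), ((((γH.1.val : GL (Fin 2) (UnitaryGroup.LocalRing L v)).val.map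
      (Pi.evalRingHom (fun w' : PlacesOver L v => w'.1.adicCompletion L) w))).charpoly).IsRoot x)
    (s : (w.1.adicCompletion L)ˣ) (k : GL (Fin 2) (w.1.adicCompletion L)) :
    ∀ x : (w.1.adicCompletion L), ¬ ((k⁻¹ * (Matrix.GeneralLinearGroup.scalar (Fin 2) s *
        ((localNonsplitEquiv (IsCMField.complexConj L) (Matrix.of fun i j : Fin 2 => if i.val + j.val + 1 = 2 then (1 : L) else 0)
          (IsCMField.complexConj_ne_one L) w hw γH.1).val : GL (Fin 2) (w.1.adicCompletion L))) * k : GL (Fin 2) (w.1.adicCompletion L)) :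
            Matrix (Fin 2) (Fin 2) (w.1.adicCompletion L)).charpoly.IsRoot x :=
  not_exists.mp (not_exists_isRoot_charpoly_rerootedCentred_ram L w hw γH hirr s k)

/-- **The discriminant depth of `B₀` is the cell's `hdisc`** (`|s| = 1` since `s·û₀₀ = 1`, `|û₀₀| = 1`). [cite: Rogawski1990, §4.9 p. 55] [cite: Kottwitz1986, §3] -/
theorem v_disc_rerootedCentred_ram
    (γH : (cmDatum L 2 (Matrix.of fun i j : Fin 2 => if i.val + j.val + 1 = 2 then (1 : L) else 0)).Local v ×
      (cmDatum L 1 (Matrix.of fun i j : Fin 1 => if i.val + j.val + 1 = 1 then (1 : L) else 0)).Local v)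
    (s : (w.1.adicCompletion L)ˣ)
    (hs : (s : w.1.adicCompletion L) * (((localNonsplitEquiv (IsCMField.complexConj L) (Matrix.of fun i j : Fin 1 => if i.val + j.val + 1 = 1 then (1 : L) else 0)
        (IsCMField.complexConj_ne_one L) w hw γH.2).val : GL (Fin 1) (w.1.adicCompletion L)) : Matrix (Fin 1) (Fin 1) (w.1.adicCompletion L)) 0 0 = 1)
    (k : GL (Fin 2) (w.1.adicCompletion L)) :
    Valued.v (((k⁻¹ * (Matrix.GeneralLinearGroup.scalar (Fin 2) s *
        ((localNonsplitEquiv (IsCMField.complexConj L) (Matrix.of fun i j : Fin 2 => if i.val + j.val + 1 = 2 then (1 : L) else 0)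
          (IsCMField.complexConj_ne_one L) w hw γH.1).val : GL (Fin 2) (w.1.adicCompletion L))) * k : GL (Fin 2) (w.1.adicCompletion L)) :
            Matrix (Fin 2) (Fin 2) (w.1.adicCompletion L)).trace ^ 2 -
        4 * ((k⁻¹ * (Matrix.GeneralLinearGroup.scalar (Fin 2) s *
        ((localNonsplitEquiv (IsCMField.complexConj L) (Matrix.of fun i j : Fin 2 => if i.val + j.val + 1 = 2 then (1 : L) else 0)
          (IsCMField.complexConj_ne_one L) w hw γH.1).val : GL (Fin 2) (w.1.adicCompletion L))) * k : GL (Fin 2) (w.1.adicCompletion L)) :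
            Matrix (Fin 2) (Fin 2) (w.1.adicCompletion L)).det) =
      Valued.v ((((γH.1.val : GL (Fin 2) (UnitaryGroup.LocalRing L v)).val.map (Pi.evalRingHom (fun w' : PlacesOver L v => w'.1.adicCompletion L) w))).trace ^ 2 -
        4 * (((γH.1.val : GL (Fin 2) (UnitaryGroup.LocalRing L v)).val.map (Pi.evalRingHom (fun w' : PlacesOver L v => w'.1.adicCompletion L) w))).det) := by
  have hs1 : Valued.v (s : w.1.adicCompletion L) = 1 := by
    have h := congrArg Valued.v hs
    rwa [map_mul, v_oneByOne_eq_one_of_local L w hw γH.2, mul_one, map_one] at h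
  rw [v_disc_rerooted_centred _ k s hs1, coe_localNonsplitEquiv_apply]


/-! ## §4 (ED. 2) THE ROOT DEPTH OF `Γ` — the pen's `hd` at `B₀` from the centring bound (A-p12 (g25)) and the scalar depth (chair F0P3a-p07 (g15)) -/

end Literature.NumberTheory.Rogawski1990

namespace Literature.NumberTheory.Automorphic.UnitaryLatticeTree

/-- **THE SCALAR DEPTH**: for `s·u₀₀ = 1`, `|s| = 1`, `|2| = 1`: `|s·(tr g ∕ 2) − 1| = |2u₀₀ − tr g|` (`s·½tr − 1 = (s∕2)·(tr − 2u₀₀)`). [cite: Kottwitz1986, §3] [cite: Rogawski1990, §4.9 p. 55] -/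
theorem v_mul_trace_div_two_sub_one_eq {K : Type*} [Field K] [Valued K ℤᵐ⁰] (h2 : Valued.v (2 : K) = 1) {s u τ : K} (hs : s * u = 1) (hsv : Valued.v s = 1) :
    Valued.v (s * (τ / 2) - 1) = Valued.v (2 * u - τ) := by
  have h20 : (2 : K) ≠ 0 := fun h0 => by rw [h0, map_zero] at h2; exact zero_ne_one h2
  have e : s * (τ / 2) - 1 = -(s / 2) * (2 * u - τ) := by
    rw [show (1 : K) = s * u from hs.symm]; field_simp; ring
  rw [e, map_mul, Valuation.map_neg, map_div₀, hsv, h2, div_one, one_mul]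

/-- **THE DEPTH OF THE RE-ROOTED CENTRED BLOCK** (generic): if `|(k⁻¹gk − ½tr g·1)_{ab}| ≤ |ϖ|^D` (the centring bound, A-p12 (g25) (4b)) and `|2u₀₀ − tr g| ≤ |ϖ|^e`
(the scalar depth, chair F0P3a-p07 (g15)'s dictionary) then for every `d ≤ D`, `d ≤ e`: **`|(s•(k⁻¹gk) − 1)ᵢⱼ| ≤ |ϖ|^d`**, `s·u₀₀ = 1`, `|s| = 1`, `|2| = 1`, `|ϖ| ≤ 1` — the
`hd ∕ hBm` input of FILE 1's `endoGL_one_mem_unitaryInt` ∕ `map_sub_one_stdLattice_le_scaleLattice_endoGL_one` at `B₀ = k⁻¹(s·g)k` (★ `coe_inv_mul_scalar_mul_mul_eq_smul`).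
[cite: Kottwitz1986, §3] [cite: Rogawski1990, §4.9 p. 55, Lemma 4.9.3] -/
theorem forall_v_smul_conj_sub_one_le_of_centre_of_scalar {K : Type*} [Field K] [Valued K ℤᵐ⁰] {ϖ : K} (hϖ1 : Valued.v ϖ ≤ 1) (h2 : Valued.v (2 : K) = 1)
    {g k : GL (Fin 2) K} {s u : K} (hs : s * u = 1) (hsv : Valued.v s = 1) {D e d : ℕ} (hdD : d ≤ D) (hde : d ≤ e)
    (hcentre : ∀ a b, Valued.v ((((k⁻¹ * g * k : GL (Fin 2) K) : Matrix (Fin 2) (Fin 2) K) - ((g : Matrix (Fin 2) (Fin 2) K).trace / 2) • (1 : Matrix (Fin 2) (Fin 2) K)) a b) ≤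
      Valued.v (ϖ ^ D))
    (hscalar : Valued.v (2 * u - (g : Matrix (Fin 2) (Fin 2) K).trace) ≤ Valued.v (ϖ ^ e)) :
    ∀ i j, Valued.v ((s • ((k⁻¹ * g * k : GL (Fin 2) K) : Matrix (Fin 2) (Fin 2) K) - 1) i j) ≤ Valued.v ϖ ^ d := by
  have hmono : ∀ {a b : ℕ}, a ≤ b → Valued.v (ϖ ^ b) ≤ Valued.v ϖ ^ a := fun {a b} hab => by
    rw [map_pow]; exact pow_le_pow_right_of_le_one' hϖ1 hab
  refine v_smul_sub_one_apply_le_of_v_sub_smul_one_le (t := (g : Matrix (Fin 2) (Fin 2) K).trace / 2) (fun a b => (hcentre a b).trans (hmono hdD)) hsv.le ?_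
  rw [v_mul_trace_div_two_sub_one_eq h2 hs hsv]
  exact hscalar.trans (hmono hde)

end Literature.NumberTheory.Automorphic.UnitaryLatticeTree

namespace Literature.NumberTheory.Rogawski1990

variable (L : Type) [Field L] [NumberField L] [IsCMField L] {v : HeightOneSpectrum (𝓞 ↥(maximalRealSubfield L))}
  (w : PlacesOver L v) (hw : IsCMField.complexConj L • w.1 = w.1)

/-- **THE ROOT DEPTH OF `Γ` AT A TAMELY RAMIFIED CM PLACE** (the pen's `hd` at `B₀ = k⁻¹(s·ĝ_w)k`): from A-p12 (g25)'s centring bound at `k` (depth `D`; their (4b) centre lemma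
`exists_unitary_conj_sub_half_trace_le_centre_of_{even,odd}_depth_ramified`, first clause, `ϖ` there a unit — instantiate at `Units.mk0 ϖ _`) and the chair's scalar depth
`|2û₀₀ − tr ĝ_w|_w ≤ |ϖ^e|` (★ `typeTwo_depthDictionary_{even,odd}_ram`, clause 2∕3: `e = m` in regime B with `=`, `e = N` in regimes A), for every `d ≤ D`, `d ≤ e`:
**`∀ i j, |(↑B₀ − 1) i j|_w ≤ |ϖ|^d`** (`|2|_w = 1` from `h2`, `|s|_w = 1` from `s·û₀₀ = 1`). [cite: Kottwitz1986, §3] [cite: Rogawski1990, §4.9 p. 55, Lemma 4.9.3] -/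
theorem forall_v_rerootedCentred_sub_one_le_ram (h2 : IsUnit (2 : (ValuativeRel.valuation (w.1.adicCompletion L)).integer))
    (ϖ : w.1.adicCompletion L) (hϖ : Valued.v ϖ = WithZero.exp (-1 : ℤ))
    (γH : (cmDatum L 2 (Matrix.of fun i j : Fin 2 => if i.val + j.val + 1 = 2 then (1 : L) else 0)).Local v ×
      (cmDatum L 1 (Matrix.of fun i j : Fin 1 => if i.val + j.val + 1 = 1 then (1 : L) else 0)).Local v)
    (s : (w.1.adicCompletion L)ˣ)
    (hs : (s : w.1.adicCompletion L) * (((localNonsplitEquiv (IsCMField.complexConj L) (Matrix.of fun i j : Fin 1 => if i.val + j.val + 1 = 1 then (1 : L) else 0)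
        (IsCMField.complexConj_ne_one L) w hw γH.2).val : GL (Fin 1) (w.1.adicCompletion L)) : Matrix (Fin 1) (Fin 1) (w.1.adicCompletion L)) 0 0 = 1)
    (k : GL (Fin 2) (w.1.adicCompletion L)) {D e d : ℕ} (hdD : d ≤ D) (hde : d ≤ e)
    (hcentre : ∀ a b : Fin 2, Valued.v ((((k⁻¹ * ((localNonsplitEquiv (IsCMField.complexConj L) (Matrix.of fun i j : Fin 2 => if i.val + j.val + 1 = 2 then (1 : L) else 0)
        (IsCMField.complexConj_ne_one L) w hw γH.1).val : GL (Fin 2) (w.1.adicCompletion L)) * k : GL (Fin 2) (w.1.adicCompletion L)) : Matrix (Fin 2) (Fin 2) (w.1.adicCompletion L)) -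
        ((((localNonsplitEquiv (IsCMField.complexConj L) (Matrix.of fun i j : Fin 2 => if i.val + j.val + 1 = 2 then (1 : L) else 0)
          (IsCMField.complexConj_ne_one L) w hw γH.1).val : GL (Fin 2) (w.1.adicCompletion L)) : Matrix (Fin 2) (Fin 2) (w.1.adicCompletion L)).trace / 2) •
          (1 : Matrix (Fin 2) (Fin 2) (w.1.adicCompletion L))) a b) ≤ Valued.v (ϖ ^ D))
    (hscalar : Valued.v (2 * finGammaTwo L v γH w - ((((γH.1.val : GL (Fin 2) (UnitaryGroup.LocalRing L v)).val.map
      (Pi.evalRingHom (fun w' : PlacesOver L v => w'.1.adicCompletion L) w)))).trace) ≤ Valued.v (ϖ ^ e)) :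
    ∀ i j, Valued.v ((((k⁻¹ * (Matrix.GeneralLinearGroup.scalar (Fin 2) s *
        ((localNonsplitEquiv (IsCMField.complexConj L) (Matrix.of fun i j : Fin 2 => if i.val + j.val + 1 = 2 then (1 : L) else 0)
          (IsCMField.complexConj_ne_one L) w hw γH.1).val : GL (Fin 2) (w.1.adicCompletion L))) * k : GL (Fin 2) (w.1.adicCompletion L)) :
            Matrix (Fin 2) (Fin 2) (w.1.adicCompletion L)) - 1) i j) ≤ Valued.v ϖ ^ d := by
  have hϖ1 : Valued.v ϖ ≤ 1 := by rw [hϖ, ← WithZero.exp_zero]; exact WithZero.exp_le_exp.2 (by norm_num)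
  have h2w : Valued.v (2 : (w.1.adicCompletion L)) = 1 := (isUnit_two_integer_iff_valued_eq_one L w.1).1 h2
  have hu1 := v_eq_one_of_map_mul_self_eq_one _ (fun x => valued_galAdicCompletionMap (L := L) (IsCMField.complexConj L) hw x)
    (map_mul_self_eq_one_of_mem_unitaryGroupOfForm_one (σ := galAdicCompletionMap (L := L) (IsCMField.complexConj L) hw)
      (u := ((localNonsplitEquiv (IsCMField.complexConj L) (Matrix.of fun i j : Fin 1 => if i.val + j.val + 1 = 1 then (1 : L) else 0)
        (IsCMField.complexConj_ne_one L) w hw γH.2).val : GL (Fin 1) (w.1.adicCompletion L)))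
      (by rw [← placeForm_antidiagOne]; exact (localNonsplitEquiv (IsCMField.complexConj L) _ (IsCMField.complexConj_ne_one L) w hw γH.2).2))
  have hsv : Valued.v (s : w.1.adicCompletion L) = 1 := by
    have h := congrArg Valued.v hs
    rwa [map_mul, hu1, mul_one, map_one] at h
  rw [coe_inv_mul_scalar_mul_mul_eq_smul]
  refine forall_v_smul_conj_sub_one_le_of_centre_of_scalar hϖ1 h2w hs hsv hdD hde hcentre ?_
  rw [coe_localNonsplitEquiv_apply]
  exact hscalar

end Literature.NumberTheory.Rogawski1990

end
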